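import Summits.AtomisticToContinuum.HydrodynamicLimit.Theorems.JParityClosureEvenStressEnskogEnskogIdentificationWeight
import Summits.AtomisticToContinuum.HydrodynamicLimit.Theorems.JParityClosureEvenStressEnskogEnskogIdentificationIntegrable
import Summits.AtomisticToContinuum.HydrodynamicLimit.Theorems.EvenStressEnskog.Negative.FrequencyLawReduction
import Literature.MathematicalPhysics.KineticTheory.EvenStatTruncationBound
import Literature.MathematicalPhysics.KineticTheory.MicroscaleWindowFunctionals
import HarnessLib

/-!
# Enskog identification from the pointwise identity (`stub_enskogIdentification_of_pointwise`,
# stub S6b of the line `stationary-microscale-hierarchy-entrance-law` of the crux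
# `JParityClosure.EvenStressEnskog`, stmt-AtomisticToContinuum-13079)

**S6b · ENSKOG IDENTIFICATION.**  The fully Maxwellian contact prediction `contactPredM` of the even
stress marks `Ξ_P^{kl}` is within `η` of the crux's own Enskog term `σ³ ∫₀^τ enskogRate(s, Φ_s z) ds`
in local-Gibbs probability, GIVEN (S6a, hypothesis `hPW`) the pointwise second-moment identity

  `ρ_r² ⟨Θ Ξ_P^{kl}⟩_{M ⊗ M} − B_r Ξ_P^{kl} = ρ_r (ρ_r ⟨F_{kl}(·, u_r, θ_r)⟩_M − ⟨b_r F_{kl}(·, u_r, θ_r)⟩_{μ_w})`,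
  `F_{kl}(v, u, θ) = ∫_{S²} ⟪v − u, ω⟫² ω_k ω_l dσ(ω)`, `M = M_{1, θ_r, u_r}`,

and GIVEN (L1, hypothesis `hL1`) one-body local Maxwellianity tested on continuous test functions of
second-moment growth.  The proof is an EXACT identity on the good set of the flow plus bookkeeping:

1. `exists_contactValue_clamp` (helper file *Weight*): a continuous `Ỹ` with `Ỹ = Y = contactValue` on a
   low-density band `(0, η_Y]`; with the stub's threshold `η₀ := min η₀^{(L1)} η_Y` and a cutoff `g`
   vanishing on `[η₀, ∞)`, the weight `kw(a) := g(a) Ỹ(a) a` is continuous, vanishes on `[η₀^{(L1)}, ∞)`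
   and satisfies `g(a) Y(a) a = kw(a)` for EVERY `a ≥ 0` (`mul_contactValue_mul_eq_weight`).
2. `enskogIdentification_algebra`, `sigma_cube_mul_integral_contactPredIntegrand_eq`,
   `contactPredM_sub_enskog_eq_oneBodyPred_sub_oneBodyStat` (this file): multiplying the pointwise
   identity by `σ³ χ g(σ³ρ_r) Y(σ³ρ_r)` and integrating over `𝕋³` and over `[0, τ]` along a GOOD orbit —
   every split integral being one of an integrable function (helper files *Fields*, *Integrable*,
   `EvenStatTruncationBound.integrable_enskogIntegrand`, `integrableOn_enskogRate_flow`) —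
   `contactPredM − σ³ ∫₀^τ enskogRate ds = oneBodyPred kw F_{kl} − oneBodyStat kw F_{kl}` for `z ∈ Φ.good`.
3. The bad set is null for the local Gibbs law (`localGibbsLaw_compl_good`), so the event of the
   conclusion is covered by (L1)'s event for `(kw, F_{kl})` and a null set; (L1) is applied per pair
   `(k, l)` with `σ₀, r₀, N₀` those of (L1).

No measurability of the events is needed (outer-measure monotonicity).

References: H. Spohn, *Large Scale Dynamics of Interacting Particles* (1991), Part I §3.2;
S. Chapman, T. G. Cowling, *The Mathematical Theory of Non-Uniform Gases* (1970), Ch. 16.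
-/

noncomputable section

open scoped BigOperators InnerProductSpace Topology ENNReal
open MeasureTheory Filter Set
open Literature.MathematicalPhysics.KineticTheory Literature.Analysis.FluidPDE
open Literature.MathematicalPhysics.KineticTheory.StationaryMicroscale

namespace Summit.AtomisticToContinuum.HydrodynamicLimit.Theorems.EvenStressEnskog

variable {N : ℕ}

/-! ## Pointwise algebra and abstract bookkeeping -/

/-- **The pointwise identity of the four integrands** (pure algebra): from the weight identity
`G Y (σ³ρ) = K` and the second-moment identity `ρ²A − B = ρ(ρP) − ρS`,
`σ³ (c G Y ρ² A) = σ³ (c G Y B) + c K ρ P − c K S`. [folklore] -/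
theorem enskogIdentification_algebra {σ3 c G Y K ρ A B P S : ℝ} (hk : G * Y * (σ3 * ρ) = K)
    (hpw : ρ ^ 2 * A - B = ρ * (ρ * P) - ρ * S) :
    σ3 * (c * G * Y * ρ ^ 2 * A) = σ3 * (c * G * Y * B) + c * K * ρ * P - c * K * S := by
  linear_combination (σ3 * c * G * Y) * hpw + (c * ρ * P - c * S) * hk

/-- **Abstract bookkeeping**: if `c f = c e + p − q` pointwise with `e, p, q` integrable, then
`c ∫ f = c ∫ e + ∫ p − ∫ q` (all splittings are of integrable functions). [folklore] -/
theorem const_mul_integral_eq_of_forall {α : Type*} [MeasurableSpace α] {μ : Measure α} {c : ℝ}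
    {f e p q : α → ℝ} (he : Integrable e μ) (hp : Integrable p μ) (hq : Integrable q μ)
    (h : ∀ a, c * f a = c * e a + p a - q a) :
    c * ∫ a, f a ∂μ = c * (∫ a, e a ∂μ) + (∫ a, p a ∂μ) - ∫ a, q a ∂μ := by
  calc c * ∫ a, f a ∂μ = ∫ a, c * f a ∂μ := (integral_const_mul c f).symm
    _ = ∫ a, (c * e a + p a - q a) ∂μ := integral_congr_ae (ae_of_all μ h)
    _ = (∫ a, (c * e a + p a) ∂μ) - ∫ a, q a ∂μ := integral_sub ((he.const_mul c).add hp) hq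
    _ = c * (∫ a, e a ∂μ) + (∫ a, p a ∂μ) - ∫ a, q a ∂μ := by
        rw [integral_add (he.const_mul c) hp, integral_const_mul]

/-! ## The identity integrated over `𝕋³` -/

/-- **The `x`-integrated identity for one configuration `w` and one time label `s`.**  With the
weight identity `g(a) Y(a) a = kw(a)` (`a ≥ 0`) and the pointwise second-moment identity at every
centre `x`, `σ³ ∫ χ g Y ρ_r² ⟨ΘΞ⟩_{M⊗M} dx = σ³ e_s(w) + ∫ χ kw ρ_r ⟨F⟩_M dx − ∫ χ kw ⟨b_r F⟩_{μ_w} dx`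
(`e_s = enskogRate`; `0 ≤ σ`, `0 < r`; the three right-hand integrands are integrable over `𝕋³`).
[folklore] -/
theorem sigma_cube_mul_integral_contactPredIntegrand_eq {σ r : ℝ} (hσ : 0 ≤ σ) (hr : 0 < r)
    {χ : ℝ × T3 → ℝ} (hχ : Continuous χ) {g : ℝ → ℝ} (hg : Continuous g) {CgY : ℝ}
    (hgY : ∀ a, 0 ≤ a → |g a * contactValue a| ≤ CgY) {kw : ℝ → ℝ} (hk : Continuous kw) {Ck : ℝ}
    (hkb : ∀ a, 0 ≤ a → |kw a| ≤ Ck) (hkw : ∀ a, 0 ≤ a → g a * contactValue a * a = kw a)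
    {Ξ : V3 × V3 × V3 → ℝ} (hΘm : Measurable fun p : V3 × V3 => sphereMark Ξ p.1 p.2) {A B : ℝ}
    (hΘ : ∀ v w, |sphereMark Ξ v w| ≤ A + B * (‖v‖ ^ 2 + ‖w‖ ^ 2)) {F : V3 × V3 × ℝ → ℝ}
    (hF : Continuous F) {CF : ℝ} (hCF : 0 ≤ CF) (hFb : ∀ v u θ, |F (v, u, θ)| ≤ CF * ‖v - u‖ ^ 2)
    (s : ℝ) (w : Config (N + 1) (Fin 3) T3)
    (hpw : ∀ x : T3,
      mollDensity r w x ^ 2 *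
          (∫ v : V3, ∫ v' : V3, sphereMark Ξ v v' *
            localMaxwellian 1 (mollTemperature r w x) (KineticEntropyBalance.uC r w x) v *
            localMaxwellian 1 (mollTemperature r w x) (KineticEntropyBalance.uC r w x) v')
        - pairFunctional r Ξ w x
      = mollDensity r w x *
          (mollDensity r w x *
            ∫ v : V3, F (v, KineticEntropyBalance.uC r w x, mollTemperature r w x) *
              localMaxwellian 1 (mollTemperature r w x) (KineticEntropyBalance.uC r w x) v)
        - mollDensity r w x *
          ∫ q, coneKernel r q.1 x * F (q.2, KineticEntropyBalance.uC r w x, mollTemperature r w x)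
            ∂(empiricalMeasure w)) :
    σ ^ 3 * ∫ x : T3, χ (s, x) * g (σ ^ 3 * mollDensity r w x) * contactValue (σ ^ 3 * mollDensity r w x) *
        mollDensity r w x ^ 2 *
        ∫ v : V3, ∫ v' : V3, sphereMark Ξ v v' *
          localMaxwellian 1 (mollTemperature r w x) (KineticEntropyBalance.uC r w x) v *
          localMaxwellian 1 (mollTemperature r w x) (KineticEntropyBalance.uC r w x) v'
      = σ ^ 3 * enskogRate σ N χ g Ξ r s w
        + (∫ x : T3, χ (s, x) * kw (σ ^ 3 * mollDensity r w x) * mollDensity r w x *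
            ∫ v : V3, F (v, KineticEntropyBalance.uC r w x, mollTemperature r w x) *
              localMaxwellian 1 (mollTemperature r w x) (KineticEntropyBalance.uC r w x) v)
        - ∫ x : T3, χ (s, x) * kw (σ ^ 3 * mollDensity r w x) *
            ∫ q, coneKernel r q.1 x * F (q.2, KineticEntropyBalance.uC r w x, mollTemperature r w x)
              ∂(empiricalMeasure w) := by
  have ha : ∀ x : T3, 0 ≤ σ ^ 3 * mollDensity r w x := fun x =>
    mul_nonneg (pow_nonneg hσ 3) (mollDensity_nonneg_of_pos hr w x)
  exact const_mul_integral_eq_of_forall (integrable_enskogIntegrand hχ hg hgY hσ hr hΘm hΘ s w)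
    (integrable_oneBodyPredIntegrand hσ hr hχ hk hkb hF hCF hFb s w)
    (integrable_oneBodyStatIntegrand hσ hr hχ hk hkb hF hCF hFb s w)
    fun x => enskogIdentification_algebra (c := χ (s, x)) (hkw _ (ha x)) (hpw x)

/-! ## Along good orbits -/

/-- **The identity of the functionals on the good set.**  For `z ∈ Φ.good`, a cutoff `g`, a weight
`kw` with `g(a) Y(a) a = kw(a)` (`a ≥ 0`), a mark `Ξ` of quadratic growth and a test function `F`
with `|F(v, u, θ)| ≤ C_F ‖v − u‖²` tied by the pointwise second-moment identity,
`contactPredM − σ³ ∫₀^τ enskogRate(s, Φ_s z) ds = oneBodyPred kw F − oneBodyStat kw F`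
(time integrability along the good orbit: `integrableOn_enskogRate_flow`,
`integrableOn_oneBodyPred_flow`, `integrableOn_oneBodyStat_flow`). [folklore] -/
theorem contactPredM_sub_enskog_eq_oneBodyPred_sub_oneBodyStat {σ : ℝ} (hσ : 0 ≤ σ)
    (Φ : HardSphereFlow (Torus.geometry (Fin 3)) (hsDiameter σ N) (N + 1))
    {z : Config (N + 1) (Fin 3) T3} (hz : z ∈ Φ.good) {r : ℝ} (hr : 0 < r) (τ : ℝ)
    {χ : ℝ × T3 → ℝ} (hχ : Continuous χ) {g : ℝ → ℝ} (hg : Continuous g) {CgY : ℝ}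
    (hgY : ∀ a, 0 ≤ a → |g a * contactValue a| ≤ CgY) {kw : ℝ → ℝ} (hk : Continuous kw) {Ck : ℝ}
    (hkb : ∀ a, 0 ≤ a → |kw a| ≤ Ck) (hkw : ∀ a, 0 ≤ a → g a * contactValue a * a = kw a)
    {Ξ : V3 × V3 × V3 → ℝ} (hΘm : Measurable fun p : V3 × V3 => sphereMark Ξ p.1 p.2) {A B : ℝ}
    (hΘ : ∀ v w, |sphereMark Ξ v w| ≤ A + B * (‖v‖ ^ 2 + ‖w‖ ^ 2)) {F : V3 × V3 × ℝ → ℝ}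
    (hF : Continuous F) {CF : ℝ} (hCF : 0 ≤ CF) (hFb : ∀ v u θ, |F (v, u, θ)| ≤ CF * ‖v - u‖ ^ 2)
    (hpw : ∀ (w : Config (N + 1) (Fin 3) T3) (x : T3),
      mollDensity r w x ^ 2 *
          (∫ v : V3, ∫ v' : V3, sphereMark Ξ v v' *
            localMaxwellian 1 (mollTemperature r w x) (KineticEntropyBalance.uC r w x) v *
            localMaxwellian 1 (mollTemperature r w x) (KineticEntropyBalance.uC r w x) v')
        - pairFunctional r Ξ w x
      = mollDensity r w x *
          (mollDensity r w x *
            ∫ v : V3, F (v, KineticEntropyBalance.uC r w x, mollTemperature r w x) *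
              localMaxwellian 1 (mollTemperature r w x) (KineticEntropyBalance.uC r w x) v)
        - mollDensity r w x *
          ∫ q, coneKernel r q.1 x * F (q.2, KineticEntropyBalance.uC r w x, mollTemperature r w x)
            ∂(empiricalMeasure w)) :
    contactPredM σ N Φ τ χ g Ξ r z - σ ^ 3 * ∫ s in Set.Icc (0 : ℝ) τ, enskogRate σ N χ g Ξ r s (Φ.flow s z)
      = oneBodyPred σ N Φ τ χ kw F r z - oneBodyStat σ N Φ τ χ kw F r z := by
  obtain ⟨Cχ, hχb⟩ := exists_abs_le_on_Icc hχ τ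
  have hIE := (integrableOn_enskogRate_flow Φ hz hχ hg hχb hgY hσ hr hΘm hΘ).integrable
  have hIP := (integrableOn_oneBodyPred_flow hσ Φ hz hr hχ hk hkb hF hCF hFb τ).integrable
  have hIS := (integrableOn_oneBodyStat_flow hσ Φ hz hr hχ hk hkb hF hCF hFb τ).integrable
  have key := const_mul_integral_eq_of_forall hIE hIP hIS fun s =>
    sigma_cube_mul_integral_contactPredIntegrand_eq hσ hr hχ hg hgY hk hkb hkw hΘm hΘ hF hCF hFb s
      (Φ.flow s z) (hpw (Φ.flow s z))
  unfold contactPredM oneBodyPred oneBodyStat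
  linear_combination key

/-! ## The event bookkeeping -/

/-- A set covered by `t` and a null set has measure at most that of `t`. [folklore] -/
theorem measure_le_of_subset_union_null {α : Type*} [MeasurableSpace α] (μ : Measure α)
    {s t n : Set α} (hn : μ n = 0) (h : s ⊆ t ∪ n) : μ s ≤ μ t :=
  (measure_mono h).trans ((measure_union_le t n).trans_eq (by rw [hn, add_zero]))

/-! ## The registered stub -/

/-- **S6b · ENSKOG IDENTIFICATION FROM THE POINTWISE IDENTITY** (registered stub
`stub_enskogIdentification_of_pointwise` of the line `stationary-microscale-hierarchy-entrance-law`):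
the pointwise second-moment identity (S6a, hypothesis `hPW`) and one-body local Maxwellianity tested
on second-moment test functions ((L1), hypothesis `hL1`) imply that the fully Maxwellian contact
prediction `contactPredM` of `Ξ_P^{kl}` is `η`-close to `σ³ ∫₀^τ enskogRate(s, Φ_s z) ds` in
local-Gibbs probability, with threshold `η₀ := min η₀^{(L1)} η_Y` (`η_Y` the band of
`exists_contactValue_clamp`) and `σ₀, r₀, N₀` those of (L1) applied to the weight
`kw(a) = g(a) Ỹ(a) a` and the test function `F_{kl}`: on the good set the difference IS
`oneBodyPred kw F_{kl} − oneBodyStat kw F_{kl}` (`contactPredM_sub_enskog_eq_oneBodyPred_sub_oneBodyStat`),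
and the bad set is null (`localGibbsLaw_compl_good`). [folklore] -/
theorem stub_enskogIdentification_of_pointwise
    (hPW : ∀ (N : ℕ) (k l : Fin 3) (r : ℝ), 0 < r → ∀ (w : Config (N + 1) (Fin 3) T3) (x : T3),
      mollDensity r w x ^ 2 *
          (∫ v : V3, ∫ v' : V3, sphereMark (evenMark k l) v v' *
            localMaxwellian 1 (mollTemperature r w x) (KineticEntropyBalance.uC r w x) v *
            localMaxwellian 1 (mollTemperature r w x) (KineticEntropyBalance.uC r w x) v')
        - pairFunctional r (evenMark k l) w x
      = mollDensity r w x *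
          (mollDensity r w x *
            ∫ v : V3, (∫ ω : Metric.sphere (0 : V3) 1,
                ⟪v - KineticEntropyBalance.uC r w x, (ω : V3)⟫_ℝ ^ 2 * ((ω : V3) k * (ω : V3) l) ∂sphereMeasure) *
              localMaxwellian 1 (mollTemperature r w x) (KineticEntropyBalance.uC r w x) v)
        - mollDensity r w x *
          ∫ q, coneKernel r q.1 x *
            (∫ ω : Metric.sphere (0 : V3) 1,
                ⟪q.2 - KineticEntropyBalance.uC r w x, (ω : V3)⟫_ℝ ^ 2 * ((ω : V3) k * (ω : V3) l) ∂sphereMeasure)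
            ∂(empiricalMeasure w))
    (hL1 : ∃ η₀ : ℝ, 0 < η₀ ∧ ∀ (a₀ θ₀ : T3 → ℝ) (u₀ : T3 → V3), Continuous a₀ → Continuous θ₀ → Continuous u₀ →
      (∀ x, 0 < a₀ x) → (∀ x, 0 < θ₀ x) → ∃ σ₀ : ℝ, 0 < σ₀ ∧ ∀ σ : ℝ, 0 < σ → σ < σ₀ →
      ∀ Φ : (N : ℕ) → HardSphereFlow (Torus.geometry (Fin 3)) (hsDiameter σ N) (N + 1), ∀ τ : ℝ, 0 < τ →
      ∀ χ : ℝ × T3 → ℝ, Continuous χ → ∀ k : ℝ → ℝ, Continuous k → (∀ a, η₀ ≤ a → k a = 0) →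
      ∀ F : V3 × V3 × ℝ → ℝ, Continuous F →
      (∃ C : ℝ, ∀ q, |F q| ≤ C * (1 + ‖q.1‖ ^ 2 + ‖q.2.1‖ ^ 2 + |q.2.2|)) →
      ∀ η δ : ℝ, 0 < η → 0 < δ → ∃ r₀ : ℝ, 0 < r₀ ∧ ∀ r : ℝ, 0 < r → r < r₀ → ∃ N₀ : ℕ, ∀ N : ℕ, N₀ ≤ N →
        localGibbsLaw σ a₀ u₀ θ₀ N (Φ N)
          {z | η < |oneBodyStat σ N (Φ N) τ χ k F r z - oneBodyPred σ N (Φ N) τ χ k F r z|}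
          ≤ ENNReal.ofReal δ) :
  ∃ η₀ : ℝ, 0 < η₀ ∧ ∀ (a₀ θ₀ : T3 → ℝ) (u₀ : T3 → V3), Continuous a₀ → Continuous θ₀ → Continuous u₀ →
    (∀ x, 0 < a₀ x) → (∀ x, 0 < θ₀ x) → ∃ σ₀ : ℝ, 0 < σ₀ ∧ ∀ σ : ℝ, 0 < σ → σ < σ₀ →
    ∀ Φ : (N : ℕ) → HardSphereFlow (Torus.geometry (Fin 3)) (hsDiameter σ N) (N + 1), ∀ τ : ℝ, 0 < τ →
    ∀ χ : ℝ × T3 → ℝ, Continuous χ → ∀ g : ℝ → ℝ, Continuous g → (∀ a, η₀ ≤ a → g a = 0) →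
    ∀ k l : Fin 3,
    ∀ η δ : ℝ, 0 < η → 0 < δ → ∃ r₀ : ℝ, 0 < r₀ ∧ ∀ r : ℝ, 0 < r → r < r₀ → ∃ N₀ : ℕ, ∀ N : ℕ, N₀ ≤ N →
      localGibbsLaw σ a₀ u₀ θ₀ N (Φ N)
        {z | η < |contactPredM σ N (Φ N) τ χ g (evenMark k l) r z
              - σ ^ 3 * ∫ s in Set.Icc (0 : ℝ) τ, enskogRate σ N χ g (evenMark k l) r s ((Φ N).flow s z)|}
        ≤ ENNReal.ofReal δ := by
  obtain ⟨η₁, hη₁, H1⟩ := hL1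
  obtain ⟨ηY, hηY, Yt, hYt, hYeq⟩ := exists_contactValue_clamp
  refine ⟨min η₁ ηY, lt_min hη₁ hηY, ?_⟩
  intro a₀ θ₀ u₀ ha₀ hθ₀ hu₀ ha₀p hθ₀p
  obtain ⟨σ₀, hσ₀, H2⟩ := H1 a₀ θ₀ u₀ ha₀ hθ₀ hu₀ ha₀p hθ₀p
  refine ⟨σ₀, hσ₀, ?_⟩
  intro σ hσ hσlt Φ τ hτ χ hχ g hg hg0 k l η δ hη hδ
  have hg0' : ∀ a, η₁ ≤ a → g a = 0 := fun a ha => hg0 a ((min_le_left _ _).trans ha)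
  have hkc : Continuous fun a => g a * Yt a * a := weight_continuous hg hYt
  have hk0 : ∀ a, η₁ ≤ a → g a * Yt a * a = 0 := weight_eq_zero_of_le hg0'
  obtain ⟨r₀, hr₀, H3⟩ := H2 σ hσ hσlt Φ τ hτ χ hχ (fun a => g a * Yt a * a) hkc hk0
    (fun q : V3 × V3 × ℝ => ∫ ω : Metric.sphere (0 : V3) 1,
      ⟪q.1 - q.2.1, (ω : V3)⟫_ℝ ^ 2 * ((ω : V3) k * (ω : V3) l) ∂sphereMeasure)
    (continuous_secondMomentTest k l) (exists_abs_secondMomentTest_le k l) η δ hη hδ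
  refine ⟨r₀, hr₀, fun r hr hrr => ?_⟩
  obtain ⟨N₀, H4⟩ := H3 r hr hrr
  refine ⟨N₀, fun N hN => ?_⟩
  obtain ⟨Ck, -, hkb⟩ := exists_bound_of_eq_zero_of_le hkc hη₁ hk0
  obtain ⟨CgY, -, hgY⟩ :=
    exists_bound_mul_contactValue_of_clamp hg hYt hYeq (lt_min hη₁ hηY) (min_le_right _ _) hg0
  have hkw : ∀ a, 0 ≤ a → g a * contactValue a * a = g a * Yt a * a := fun a ha =>
    mul_contactValue_mul_eq_weight hYeq (min_le_right _ _) hg0 ha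
  refine (measure_le_of_subset_union_null (localGibbsLaw σ a₀ u₀ θ₀ N (Φ N))
    (localGibbsLaw_compl_good (Φ N)) fun z hz => ?_).trans (H4 N hN)
  by_cases hzg : z ∈ (Φ N).good
  · refine Set.mem_union_left _ ?_
    rw [mem_setOf_eq] at hz ⊢
    rw [contactPredM_sub_enskog_eq_oneBodyPred_sub_oneBodyStat hσ.le (Φ N) hzg hr τ hχ hg hgY hkc hkb
      hkw (continuous_sphereMark_uncurry (continuous_evenMark k l)).measurable
      (abs_sphereMark_evenMark_le' k l) (continuous_secondMomentTest k l)
      (CF := sphereMeasure.real (univ : Set (Metric.sphere (0 : V3) 1))) measureReal_nonneg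
      (fun v u _ => abs_secondMomentTest_le k l v u) (fun w x => hPW N k l r hr w x),
      abs_sub_comm] at hz
    exact hz
  · exact Set.mem_union_right _ (Set.mem_compl hzg)

end Summit.AtomisticToContinuum.HydrodynamicLimit.Theorems.EvenStressEnskog

end
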